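import Mathlib
import HarnessLib
import Summits.KontsevichZagierPeriods.Zeta5Search.Denom.CatalanRayDigitsC
import Summits.KontsevichZagierPeriods.Zeta5Search.Denom.CatalanRayAtoms

/-!
# CatalanRayPClosed — the explicit rational part of the slid Catalan-ray forms and its integrality (Theorem K6, kernel form, odd primes AND the prime 2)

HONEST FRAMING: systematic search; no irrationality claim unless certified.

fam-denom (pub-zeta5), FAMILY.md §6 D9.  For the directions `(H,J,K,L,M) = (n, J, n, J+n, n)`, `J ≥ 3n` (the rays
`J = jn`, `j ≥ 3`, of `families/denom/CATK6.md`), the linear form `Jsym = Σ_{μ ≥ L} t_μ R(μ+½)` equals, after SLIDING the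
expansion point to `L′ = n` (CATK6 §1: `F₁(μ+½) = 0` for `μ ∈ [L−S, L−1]`), `Σ_{ν≥0} t_ν R_n(ν+½)` with
`R_n(T) = (½)_n · Π_{i<J+n}(T − J + ½ + i) / (Π_{0≤i≤J}(T − J + n + i) · Π_{e<2n}(T + e + 1))`
(poles `T = c ∈ [0, J−n]` simple, `T = −a`, `1 ≤ a ≤ n` double, `n < a ≤ 2n` simple).  Partial fractions against the
closed-form atoms of CATK1 Lemma S (`S₁(a) = 2t_{a−1}σ(a)`, `S₁(−c) = 8C(2c,c)4^{−c}(G − gsum c)`, `S₂(a) = t_{a−1}(W(a) − 8G)`)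
give `Jsym = Q·G + P` with the EXPLICIT rational part `PClosed n J` defined below (pole coefficient × atom, summed over
the three pole families; a transcription of `families/denom/k6/shiftrep.py`, which reproduces fam-catalan's cached
`(P_n, Q_n)` on every direction and shift — 0 mismatches; the transcription itself re-checked against it on 58 `(n, J)`).

PROVED here (complete kernel proofs): the kernel sanity values `PClosed 1 3 = −32297/4608`, `PClosed 1 4 = −2890747/368640`
(= shiftrep), the exact `p`-adic valuations of the pole coefficients as signed sums of `v_p(N!)` — they are the level
sums `vAlpha / vBeta / vGamma` of `CatalanRayDigits` Part C plus the atom — the fourth atom lemma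
`logDer_padicValRat_ge : v_p(Λ_a) ≥ −⌊log_p(2X−1)⌋` (`X = a + J`), and the assembly
**`PClosed_oddInt : J ≥ 3n → n ≥ 1 → p odd prime → −(⌊log_p(J+n)⌋ + ⌊log_p max(J,4n−1)⌋) ≤ v_p(PClosed n J)`**,
i.e. `d*_{J+n} · d*_{max(J,4n−1)} · PClosed n J ∈ ℤ[1/2]` — Theorem K6 of CATK6 for the explicit rational part —
and its ray corollary **`rayPClosed_oddInt`** (`j ≥ 3`, `n ≥ 1`, odd `p`:
`−(⌊log_p((j+1)n)⌋ + ⌊log_p max(jn,4n−1)⌋) ≤ v_p(rayPClosed j n)`).  The bound is attained (`v₃(PClosed 1 3) = −2`).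
Inputs BY NAME: the per-term allowances `termAlpha/termBetaB/termBetaA/termGamma` of `CatalanRayDigits` (digit
inequalities + Legendre) and the atom lemmas `gsumAtom/Watom/sigmaAtom_padicValRat_ge`, `le_padicValRat_sum` of
`CatalanRayAtoms`; terms with a vanishing atom factor are `0` and need no bound (so no positivity of `W(a)` is used).
PART 2 (`CatalanRayPClosedTwo` + `CatalanRayPClosedInt`, fam-denom D9b): the PRIME 2 and the INTEGRALITY PACKAGING —
**`PClosed_twoInt : J ≥ 3n → n ≥ 1 → −(4J+2n) ≤ v₂(PClosed n J)`** (termwise, crude Legendre; `rayPClosed_twoInt`: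
`−2(2j+1)n ≤ v₂`), `dstarOdd N = ∏_{p odd prime ≤ N} p^{⌊log_p N⌋}` with `padicValRat_dstarOdd`, the general
`exists_int_of_padicValRat_nonneg`, and **`PClosed_isInt : ∃ z : ℤ, z = d*_{J+n}·d*_{max(J,4n−1)}·2^{4J+2n}·PClosed n J`**,
**`rayPClosed_isInt (j ≥ 4, n ≥ 1) : ∃ z : ℤ, z = d*_{(j+1)n}·d*_{jn}·2^{2(2j+1)n}·rayPClosed j n`** — the
integrality `rayMult j n · P ∈ ℤ` of fam-catalan's `RayIntegrality j`, for the closed form.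
NOT typed here (answer to referee R-2, 00:19Z (d)): the identification `PClosed n (jn) = P_n` with the rational part of
the tree's `Jsym`-decomposition is NOT proved in Lean for any `n` — only the two `n = 1` values above are kernel-evaluated
(and agree with fam-catalan's `P₁` on rays 3, 4); for general `(n, J)` the agreement is an exact-arithmetic CHECK outside
Lean (`shiftrep.py` vs the cached rows, 0 mismatches; `pclosed.py` vs `shiftrep.py` on 58 pairs).  The identification needs
`Jsym` as the hypergeometric-type series (same status as `CatalanQBridge.QClosed` before `bridgeLaw_holds`).  Also not
typed: the rays `j ∈ {1,2}` (other envelope).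
FILE LAYOUT (400-line lint): this file = the representation (`PClosed`, `rayPClosed`), the kernel sanity values, the
valuation toolkit and the family-α blocks; `CatalanRayPClosedOdd` = families β/γ, the `Λ_a` atom and the assembly
`PClosed_oddInt` / `rayPClosed_oddInt`; `CatalanRayPClosedTwo` = the 2-adic toolkit, coefficient valuations and atom
bounds; `CatalanRayPClosedInt` = the 2-adic term bounds, `PClosed_twoInt`, `dstarOdd` and the packaging `PClosed_isInt` /
`rayPClosed_isInt`.  The theorem list in this docstring refers to the four files together.
-/

namespace Summit.KontsevichZagierPeriods.Zeta5Search.Denom.CatalanRayPClosed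

open Finset
open Summit.KontsevichZagierPeriods.Zeta5Search.Denom.CatalanRayAtoms
open Summit.KontsevichZagierPeriods.Zeta5Search.Denom.CatalanRayDigits

/-! ### The representation (CATK6 §1, `k6/shiftrep.py` with `Lp = n`) -/

/-- `(½)_n = Π_{i<n}(½ + i)`. -/
def K0 (n : ℕ) : ℚ := ∏ i ∈ range n, ((1 : ℚ) / 2 + i)

/-- numerator of `R_n` at `T = d`: `N(d) = Π_{i<J+n}(d − J + ½ + i)`. -/
def Nnum (n J : ℕ) (d : ℚ) : ℚ := ∏ i ∈ range (J + n), (d - J + 1 / 2 + i)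

/-- a vanishing factor is skipped (the pole's own factor). -/
def skip (x : ℚ) : ℚ := if x = 0 then 1 else x

/-- first denominator family `Π_{0≤i≤J}(d − J + n + i)`, own factor skipped. -/
def D1 (n J : ℕ) (d : ℚ) : ℚ := ∏ i ∈ range (J + 1), skip (d - J + n + i)

/-- second denominator family `Π_{e<2n}(d + e + 1)`, own factor skipped. -/
def D2 (n : ℕ) (d : ℚ) : ℚ := ∏ e ∈ range (2 * n), skip (d + e + 1)

/-- the pole coefficient `g(d) = [(T−d)^{m_d} R_n(T)]_{T=d}` (`A_d` at a simple pole, `B_a` at a double pole `d = −a`). -/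
def coef (n J : ℕ) (d : ℚ) : ℚ := K0 n * Nnum n J d / (D1 n J d * D2 n d)

/-- the logarithmic derivative `Λ = [d/dT log((T−d)² R_n(T))]_{T=d}` at a double pole (`x⁻¹ = 0` at `x = 0` skips the
own factors); `A′_a = B_a · Λ_a`. -/
def logDer (n J : ℕ) (d : ℚ) : ℚ :=
  (∑ i ∈ range (J + n), (d - J + 1 / 2 + i)⁻¹) - (∑ i ∈ range (J + 1), (d - J + n + i)⁻¹)
    - ∑ e ∈ range (2 * n), (d + e + 1)⁻¹

/-- `t_{a−1} = B(a, ½) = 2·4^{a−1}((a−1)!)²/(2a−1)!`. -/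
def tB (a : ℕ) : ℚ := 2 * 4 ^ (a - 1) * ((a - 1).factorial : ℚ) ^ 2 / ((2 * a - 1).factorial : ℚ)

/-- type α term (simple pole `T = c ≥ 0`): `A_c · S₁(−c)_rat = A_c · (−8C(2c,c)4^{−c} gsum(c))`. -/
def termA (n J c : ℕ) : ℚ := coef n J c * (-(8 * (Nat.choose (2 * c) c : ℚ) / 4 ^ c) * gsumAtom c)

/-- type β, `B`-part (double pole `T = −a`, `1 ≤ a ≤ n`): `B_a · S₂(a)_rat = B_a · t_{a−1} W(a)`. -/
def termBB (n J a : ℕ) : ℚ := coef n J (-(a : ℚ)) * (tB a * Watom a)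

/-- type β, `A′`-part: `A′_a · S₁(a)_rat = B_a Λ_a · 2t_{a−1}σ(a)`. -/
def termBA (n J a : ℕ) : ℚ := coef n J (-(a : ℚ)) * logDer n J (-(a : ℚ)) * (2 * tB a * sigmaAtom a)

/-- type γ term (simple pole `T = −a`, `n < a ≤ 2n`): `A_a · 2t_{a−1}σ(a)`. -/
def termG (n J a : ℕ) : ℚ := coef n J (-(a : ℚ)) * (2 * tB a * sigmaAtom a)

/-- **The explicit rational part** of the slid representation of `J(n, J, n, J+n, n)`. -/
def PClosed (n J : ℕ) : ℚ :=
  (∑ c ∈ range (J - n + 1), termA n J c) + (∑ a ∈ Icc 1 n, (termBB n J a + termBA n J a))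
    + ∑ a ∈ Icc (n + 1) (2 * n), termG n J a

/-- on the ray `j`: `P_n^{closed} = PClosed n (jn)`. -/
def rayPClosed (j n : ℕ) : ℚ := PClosed n (j * n)

/-! ### Kernel sanity values (= `k6/shiftrep.PQ(1,3,1,4,1,1)`, `PQ(1,4,1,5,1,1)`) -/

/-- kernel sanity value on the ray `j = 3`, `n = 1` (= `shiftrep.PQ(1,3,1,4,1,1)[0]`; `4608 = 2⁹·3²`, so `v₃ = −2` = the bound of `PClosed_oddInt` at `p = 3`: tight). -/
theorem PClosed_one_three : PClosed 1 3 = -32297 / 4608 := by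
  norm_num [PClosed, termA, termBB, termBA, termG, coef, K0, Nnum, D1, D2, skip, logDer, tB, gsumAtom, Watom, wTerm,
    wInc₁, wInc₂, sigmaAtom, Finset.sum_range_succ, Finset.prod_range_succ, Finset.sum_Icc_succ_top, Nat.choose_succ_succ,
    Nat.factorial]

/-- kernel sanity value on the ray `j = 4`, `n = 1` (= shiftrep; `368640 = 2¹³·3²·5`: `v₃ = −2`, `v₅ = −1`, bounds `−2`, `−2`). -/
theorem PClosed_one_four : PClosed 1 4 = -2890747 / 368640 := by
  norm_num [PClosed, termA, termBB, termBA, termG, coef, K0, Nnum, D1, D2, skip, logDer, tB, gsumAtom, Watom, wTerm,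
    wInc₁, wInc₂, sigmaAtom, Finset.sum_range_succ, Finset.prod_range_succ, Finset.sum_Icc_succ_top, Nat.choose_succ_succ,
    Nat.factorial]

/-! ### Valuation toolkit -/

/-- The sum of the `v_p` of non-zero rationals is `v_p` of their product (stated sum-first; used as
`rw [← padicValRat_prod hf]`). -/
theorem padicValRat_prod {p : ℕ} [Fact p.Prime] {ι : Type*} {f : ι → ℚ} {s : Finset ι}
    (hf : ∀ i ∈ s, f i ≠ 0) :
    ∑ i ∈ s, padicValRat p (f i) = padicValRat p (∏ i ∈ s, f i) := by
  classical
  symm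
  revert hf
  refine Finset.induction_on s ?_ ?_
  · intro _; simp
  · intro a s ha ih hf
    have hfa : f a ≠ 0 := hf a (Finset.mem_insert_self a s)
    have hfs : ∀ i ∈ s, f i ≠ 0 := fun i hi => hf i (Finset.mem_insert_of_mem hi)
    have hps : ∏ i ∈ s, f i ≠ 0 := Finset.prod_ne_zero_iff.mpr hfs
    rw [Finset.prod_insert ha, Finset.sum_insert ha, padicValRat.mul hfa hps, ih hfs]

/-- shorthand `v_p(N!)` in `ℤ`. -/
def vf (p N : ℕ) : ℤ := ((padicValNat p N.factorial : ℕ) : ℤ)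

/-- `Σ_{i<K} v_p(i+1) = v_p(K!)`. -/
theorem intBlock (p : ℕ) [hp : Fact p.Prime] (K : ℕ) :
    ∑ i ∈ range K, ((padicValNat p (i + 1) : ℕ) : ℤ) = vf p K := by
  unfold vf
  induction K with
  | zero => simp
  | succ K ih =>
    rw [Finset.sum_range_succ, ih, Nat.factorial_succ, padicValNat.mul (by omega) (Nat.factorial_ne_zero K)]
    simp only [Nat.cast_add]; ring

/-- `Σ_{i<K} v_p(2i+1) = v_p((2K)!) − v_p(K!)` for odd `p` (`(2K−1)!! = (2K)!/(2^K K!)`). -/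
theorem oddBlock (p : ℕ) [hp : Fact p.Prime] (hp2 : p ≠ 2) (K : ℕ) :
    ∑ i ∈ range K, ((padicValNat p (2 * i + 1) : ℕ) : ℤ) = vf p (2 * K) - vf p K := by
  unfold vf
  induction K with
  | zero => simp
  | succ K ih =>
    rw [Finset.sum_range_succ, ih]
    have e1 : (2 * (K + 1)).factorial = (2 * K).factorial * (2 * K + 1) * (2 * (K + 1)) := by
      rw [show 2 * (K + 1) = (2 * K + 1) + 1 by ring, Nat.factorial_succ, Nat.factorial_succ]; ring
    have e2 : padicValNat p (2 * (K + 1)).factorial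
        = padicValNat p (2 * K).factorial + padicValNat p (2 * K + 1) + padicValNat p (K + 1) := by
      rw [e1, padicValNat.mul (by positivity) (by omega), padicValNat.mul (by positivity) (by omega),
        padicValNat.mul (by norm_num) (by omega), padicValNat_two_eq_zero hp2, zero_add]
    rw [e2, Nat.factorial_succ, padicValNat.mul (by omega) (Nat.factorial_ne_zero K)]
    simp only [Nat.cast_add]; ring

/-- `v_p((2k+1)/2) = v_p(2k+1)` for odd `p`. -/
theorem v_halfodd_pos {p : ℕ} [Fact p.Prime] (hp2 : p ≠ 2) (k : ℕ) :
    padicValRat p (((2 * k + 1 : ℕ) : ℚ) / 2) = ((padicValNat p (2 * k + 1) : ℕ) : ℤ) := by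
  have hk : ((2 * k + 1 : ℕ) : ℚ) ≠ 0 := by positivity
  rw [padicValRat.div hk two_ne_zero, padicValRat.of_nat, show (2 : ℚ) = ((2 : ℕ) : ℚ) by norm_num, padicValRat.of_nat,
    padicValNat_two_eq_zero hp2]
  simp

/-- `v_p(−(2k+1)/2) = v_p(2k+1)` for odd `p`. -/
theorem v_halfodd_neg {p : ℕ} [Fact p.Prime] (hp2 : p ≠ 2) (k : ℕ) :
    padicValRat p (-(((2 * k + 1 : ℕ) : ℚ) / 2)) = ((padicValNat p (2 * k + 1) : ℕ) : ℤ) := by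
  rw [padicValRat.neg]; exact v_halfodd_pos hp2 k

/-- `v_p(−k) = v_p(k)`. -/
theorem v_negnat {p : ℕ} [Fact p.Prime] (k : ℕ) : padicValRat p (-(k : ℚ)) = ((padicValNat p k : ℕ) : ℤ) := by
  rw [padicValRat.neg, padicValRat.of_nat]

/-- `v_p(2) = 0` for odd `p`. -/
theorem v_two {p : ℕ} [Fact p.Prime] (hp2 : p ≠ 2) : padicValRat p (2 : ℚ) = 0 := by
  rw [show (2 : ℚ) = ((2 : ℕ) : ℚ) by norm_num, padicValRat.of_nat, padicValNat_two_eq_zero hp2]; simp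

/-- `(½)_n ≠ 0`. -/
theorem K0_ne (n : ℕ) : K0 n ≠ 0 := Finset.prod_ne_zero_iff.mpr (fun i _ => by positivity)

/-- `v_p((½)_n) = v_p((2n)!) − v_p(n!)` for odd `p` (`(½)_n = (2n)!/(4ⁿ n!)`). -/
theorem v_K0 {p : ℕ} [Fact p.Prime] (hp2 : p ≠ 2) (n : ℕ) : padicValRat p (K0 n) = vf p (2 * n) - vf p n := by
  unfold K0
  rw [← padicValRat_prod (fun i _ => by positivity), ← oddBlock p hp2 n]
  refine Finset.sum_congr rfl (fun i _ => ?_)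
  rw [show (1 : ℚ) / 2 + i = ((2 * i + 1 : ℕ) : ℚ) / 2 by push_cast; ring]
  exact v_halfodd_pos hp2 i

/-- `t_{a−1} ≠ 0`. -/
theorem tB_ne (a : ℕ) : ¬ tB a = 0 := fun h => absurd h (by unfold tB; positivity)

/-- `v_p(t_{a−1}) = 2v_p((a−1)!) − v_p((2a−1)!)` for odd `p`. -/
theorem v_tB {p : ℕ} [Fact p.Prime] (hp2 : p ≠ 2) (a : ℕ) :
    padicValRat p (tB a) = 2 * vf p (a - 1) - vf p (2 * a - 1) := by
  unfold tB vf
  have hf1 : (((a - 1).factorial : ℕ) : ℚ) ≠ 0 := by positivity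
  have hf2 : (((2 * a - 1).factorial : ℕ) : ℚ) ≠ 0 := by positivity
  have h4 : ((4 : ℚ)) ^ (a - 1) ≠ 0 := by positivity
  rw [padicValRat.div (by positivity) hf2, padicValRat.mul (by positivity) (pow_ne_zero 2 hf1),
    padicValRat.mul two_ne_zero h4, padicValRat.pow, padicValRat.pow, padicValRat.of_nat, padicValRat.of_nat,
    show (2 : ℚ) = ((2 : ℕ) : ℚ) by norm_num, show (4 : ℚ) = ((4 : ℕ) : ℚ) by norm_num, padicValRat.of_nat,
    padicValRat.of_nat, padicValNat_two_eq_zero hp2, padicValNat_four_eq_zero hp2]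
  push_cast; ring

/-! ### Family α (simple poles `T = c`, `0 ≤ c ≤ J − n`; write `J = m + c`, `m ≥ n`) -/

/-- the numerator at a pole `T = c` does not vanish (its factors are half-odd integers). -/
theorem Nnum_alpha_ne (n m c : ℕ) : Nnum n (m + c) c ≠ 0 := by
  unfold Nnum
  refine Finset.prod_ne_zero_iff.mpr (fun i _ => ?_)
  intro h
  have h1 : (2 : ℚ) * (i : ℕ) + 1 = 2 * (m : ℕ) := by push_cast at h ⊢; linarith
  have h2 : 2 * i + 1 = 2 * m := by exact_mod_cast h1
  omega

/-- α (`J = m + c`): `v_p(N(c)) = [v_p((2m)!) − v_p(m!)] + [v_p((2(c+n))!) − v_p((c+n)!)]` (`|N(c)| = (2m−1)!!(2c+2n−1)!!/2^{J+n}`). -/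
theorem v_Nnum_alpha {p : ℕ} [Fact p.Prime] (hp2 : p ≠ 2) (n m c : ℕ) :
    padicValRat p (Nnum n (m + c) c) = (vf p (2 * m) - vf p m) + (vf p (2 * (c + n)) - vf p (c + n)) := by
  unfold Nnum
  rw [← padicValRat_prod (fun i hi => (Finset.prod_ne_zero_iff.mp (Nnum_alpha_ne n m c)) i hi),
    show m + c + n = m + (c + n) by ring, Finset.sum_range_add, ← oddBlock p hp2 m, ← oddBlock p hp2 (c + n),
    ← Finset.sum_range_reflect (fun i => ((padicValNat p (2 * i + 1) : ℕ) : ℤ)) m]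
  congr 1
  · refine Finset.sum_congr rfl (fun i hi => ?_)
    rw [Finset.mem_range] at hi
    obtain ⟨k, hk⟩ : ∃ k, m = i + k + 1 := ⟨m - 1 - i, by omega⟩
    rw [show m - 1 - i = k by omega,
      show (c : ℚ) - ((m + c : ℕ) : ℚ) + 1 / 2 + (i : ℕ) = -(((2 * k + 1 : ℕ) : ℚ) / 2) by rw [hk]; push_cast; ring]
    exact v_halfodd_neg hp2 _
  · refine Finset.sum_congr rfl (fun i _ => ?_)
    rw [show (c : ℚ) - ((m + c : ℕ) : ℚ) + 1 / 2 + ((m + i : ℕ) : ℚ) = ((2 * i + 1 : ℕ) : ℚ) / 2 by push_cast; ring]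
    exact v_halfodd_pos hp2 _

/-- a skipped product factor is never zero. -/
theorem skip_ne (x : ℚ) : skip x ≠ 0 := by unfold skip; split_ifs with h <;> simp_all

/-- `D1 ≠ 0`. -/
theorem D1_ne (n J : ℕ) (d : ℚ) : D1 n J d ≠ 0 := Finset.prod_ne_zero_iff.mpr (fun _ _ => skip_ne _)
/-- `D2 ≠ 0`. -/
theorem D2_ne (n : ℕ) (d : ℚ) : D2 n d ≠ 0 := Finset.prod_ne_zero_iff.mpr (fun _ _ => skip_ne _)

/-- α (`J = m + c`, `n ≤ m`): `v_p(D1(c)) = v_p((m−n)!) + v_p((c+n)!)`. -/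
theorem v_D1_alpha {p : ℕ} [Fact p.Prime] (n m c : ℕ) (hmn : n ≤ m) :
    padicValRat p (D1 n (m + c) c) = vf p (m - n) + vf p (c + n) := by
  unfold D1
  rw [← padicValRat_prod (fun i _ => skip_ne _), show m + c + 1 = (m - n) + (1 + (c + n)) by omega,
    Finset.sum_range_add, Finset.sum_range_add, ← intBlock p (m - n), ← intBlock p (c + n),
    ← Finset.sum_range_reflect (fun i => ((padicValNat p (i + 1) : ℕ) : ℤ)) (m - n)]
  have hmid : padicValRat p (skip ((c : ℚ) - ((m + c : ℕ) : ℚ) + n + (((m - n) + 0 : ℕ) : ℚ))) = 0 := by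
    rw [show (c : ℚ) - ((m + c : ℕ) : ℚ) + n + (((m - n) + 0 : ℕ) : ℚ) = 0 by
      obtain ⟨k, hk⟩ : ∃ k, m = n + k := ⟨m - n, by omega⟩
      rw [show m - n = k by omega, hk]; push_cast; ring]
    simp [skip]
  rw [Finset.sum_range_one, hmid, zero_add]
  congr 1
  · refine Finset.sum_congr rfl (fun i hi => ?_)
    rw [Finset.mem_range] at hi
    obtain ⟨k, hk⟩ : ∃ k, m = n + i + k + 1 := ⟨m - n - 1 - i, by omega⟩
    have e : (c : ℚ) - ((m + c : ℕ) : ℚ) + n + (i : ℕ) = -(((m - n - 1 - i + 1 : ℕ) : ℚ)) := by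
      rw [show m - n - 1 - i = k by omega, hk]; push_cast; ring
    rw [e, skip, if_neg (neg_ne_zero.mpr (by positivity))]
    exact v_negnat _
  · refine Finset.sum_congr rfl (fun i _ => ?_)
    have e : (c : ℚ) - ((m + c : ℕ) : ℚ) + n + (((m - n) + (1 + i) : ℕ) : ℚ) = ((i + 1 : ℕ) : ℚ) := by
      obtain ⟨k, hk⟩ : ∃ k, m = n + k := ⟨m - n, by omega⟩
      rw [show m - n = k by omega, hk]; push_cast; ring
    rw [e, skip, if_neg (by positivity)]
    exact padicValRat.of_nat

/-- α: `v_p(D2(c)) = v_p((c+2n)!) − v_p(c!)`. -/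
theorem v_D2_alpha {p : ℕ} [Fact p.Prime] (n c : ℕ) :
    padicValRat p (D2 n c) = vf p (c + 2 * n) - vf p c := by
  unfold D2
  rw [← padicValRat_prod (fun i _ => skip_ne _)]
  have h := intBlock p (c + 2 * n)
  rw [Finset.sum_range_add, intBlock p c] at h
  have hs : ∑ e ∈ range (2 * n), padicValRat p (skip ((c : ℚ) + (e : ℕ) + 1))
      = ∑ e ∈ range (2 * n), ((padicValNat p (c + e + 1) : ℕ) : ℤ) := by
    refine Finset.sum_congr rfl (fun e _ => ?_)
    rw [show (c : ℚ) + (e : ℕ) + 1 = ((c + e + 1 : ℕ) : ℚ) by push_cast; ring, skip, if_neg (by positivity)]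
    exact padicValRat.of_nat
  rw [hs]; linarith

/-- the pole coefficient does not vanish (given the numerator does not). -/
theorem coef_ne (n J : ℕ) (d : ℚ) (hN : Nnum n J d ≠ 0) : coef n J d ≠ 0 := by
  unfold coef
  exact div_ne_zero (mul_ne_zero (K0_ne n) hN) (mul_ne_zero (D1_ne n J d) (D2_ne n d))

/-- valuation of the α-coefficient `A_c` (`J = m + c`). -/
theorem v_coef_alpha {p : ℕ} [Fact p.Prime] (hp2 : p ≠ 2) (n m c : ℕ) (hmn : n ≤ m) :
    padicValRat p (coef n (m + c) c)
      = (vf p (2 * n) - vf p n) + ((vf p (2 * m) - vf p m) + (vf p (2 * (c + n)) - vf p (c + n)))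
        - ((vf p (m - n) + vf p (c + n)) + (vf p (c + 2 * n) - vf p c)) := by
  unfold coef
  rw [padicValRat.div (mul_ne_zero (K0_ne n) (Nnum_alpha_ne n m c)) (mul_ne_zero (D1_ne _ _ _) (D2_ne _ _)),
    padicValRat.mul (K0_ne n) (Nnum_alpha_ne n m c), padicValRat.mul (D1_ne _ _ _) (D2_ne _ _),
    v_K0 hp2, v_Nnum_alpha hp2, v_D1_alpha n m c hmn, v_D2_alpha]

/-- valuation of the α-term: `v_p(A_c · 8C(2c,c)4^{−c} · gsum c) = vAlpha + v_p(gsum c)` (when `gsum c ≠ 0`). -/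
theorem v_termA {p : ℕ} [Fact p.Prime] (hp2 : p ≠ 2) (n m c : ℕ) (hmn : n ≤ m) (hg : gsumAtom c ≠ 0) :
    padicValRat p (termA n (m + c) c) = vAlpha p n c m + padicValRat p (gsumAtom c) := by
  unfold termA
  have hC : (Nat.choose (2 * c) c : ℚ) ≠ 0 := by exact_mod_cast (Nat.choose_pos (by omega)).ne'
  have h8 : -(8 * (Nat.choose (2 * c) c : ℚ) / 4 ^ c) ≠ 0 := by
    rw [neg_ne_zero]; positivity
  rw [padicValRat.mul (coef_ne _ _ _ (Nnum_alpha_ne n m c)) (mul_ne_zero h8 hg), padicValRat.mul h8 hg,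
    v_coef_alpha hp2 n m c hmn, padicValRat.neg, padicValRat.div (by positivity) (by positivity),
    padicValRat.mul (by norm_num) hC, padicValRat.pow,
    show (8 : ℚ) = ((8 : ℕ) : ℚ) by norm_num, show (4 : ℚ) = ((4 : ℕ) : ℚ) by norm_num,
    padicValRat.of_nat, padicValRat.of_nat, padicValRat.of_nat, padicValNat_eight_eq_zero hp2,
    padicValNat_four_eq_zero hp2]
  have hcc : padicValNat p (Nat.choose (2 * c) c) + padicValNat p c.factorial + padicValNat p c.factorial
      = padicValNat p (2 * c).factorial := by
    have h := Nat.choose_mul_factorial_mul_factorial (show c ≤ 2 * c by omega)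
    rw [show 2 * c - c = c by omega] at h
    rw [← padicValNat.mul (Nat.choose_pos (by omega)).ne' (Nat.factorial_ne_zero c),
      ← padicValNat.mul (mul_ne_zero (Nat.choose_pos (by omega)).ne' (Nat.factorial_ne_zero c)) (Nat.factorial_ne_zero c), h]
  unfold vAlpha vf
  have hcc' : ((padicValNat p (Nat.choose (2 * c) c) : ℕ) : ℤ)
      = (padicValNat p (2 * c).factorial : ℕ) - (padicValNat p c.factorial : ℕ) - (padicValNat p c.factorial : ℕ) := by
    rw [← hcc]; push_cast; ring
  push_cast [hcc'] at *
  ring_nf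

end Summit.KontsevichZagierPeriods.Zeta5Search.Denom.CatalanRayPClosed
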